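import Literature.NumberTheory.EllipticCurves.BSDRootNumberSmallConductorProofs
import Literature.NumberTheory.EllipticCurves.TamagawaFiniteIndexProofs
import Literature.NumberTheory.EllipticCurves.MazurTorsionGaloisStructureProofs
import HarnessLib

/-!
# BSD in analytic rank `≤ 1`: from the PRINT SHAPE of a `p`-part theorem to Miller's `BSD(E,p)` — the bridge used by every residual-class theorem

HONEST FRAMING (cell `b2b-bsdres`, `run/shared/lean/b2b/bsd-rank1-residual/`): the goal of the cell
is to DELETE the COMBINATION-SHAPED residual classes of the BSD formula for ALL analytic-rank `≤ 1`
elliptic curves over `ℚ` — "full BSD formula for every rank `≤ 1` curve in class `C`" assembled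
STRICTLY from published theorems — so that the remainder becomes exactly the CONSTRUCTION-SHAPED
classes, which are TYPED (missing-input `Prop`s), NOT attempted. This is not "finishing BSD".

THEOREMS ONLY (no definition, no named fact). The published `p`-part theorems the cell cites
(Skinner–Urban 2014 Thm. 2, Skinner 2016 Thm. C, Jetchev–Skinner–Wan 2017 Thm. 1.2.1, Castella 2018
Thm. A, W. Zhang 2014 Thm. 1.6, Burungale–Castella–Skinner 2025 Cor. 1.3.1, Castella–Grossi–Skinner
2025 Thm. 4, …) all conclude, for a curve with `E[p]` irreducible and `ord_{s=1} L(E,s) = r ≤ 1`, in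
the PRINT SHAPE
  `ord_p( L^{(r)}(E,1) / (r! · Ω_E · Reg(E/ℚ)) ) = ord_p( #Ш(E/ℚ) · ∏_ℓ c_ℓ )`
(no torsion term), transcribed in the tree — as in bsd.S30 `padicValRat_bsd_rank_zero` — as
"`W.leadingLCoeff / (W.realPeriodRat · W.regulator)` is a rational `q` with
`padicValRat p q = ord_p W.shaOrder + ord_p W.tamagawaProduct`" for a globally minimal `W`. The
cell's currency is Miller's `BSD(E,p)` = `BSDp W p` (`rank = r_an`, `Ш(p)` finite, `#Ш_an ∈ ℚ`,
`ord_p #Ш_an = ord_p #Ш(p)`; Miller, LMS J. Comput. Math. 14 (2011), Def. 1.1; file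
`BSDRootNumberSmallConductorProofs`). This file proves, once and for all classes:

* `padicValNat_torsionOrder_eq_zero_of_irreducible`: `E[p]` irreducible ⇒ `ord_p #E(ℚ)_tors = 0`
  (Cauchy in the finite group `E(ℚ)_tors` + Mazur 1977 p. 157, tree theorem
  `not_exists_addOrderOf_eq_of_hasIrreducibleModPGaloisRep`; the auxiliary
  `addOrderOf_point_eq_of_subsingleton` moves between the two `DecidableEq ℚ` instances under
  which the tree states its general-field and its `ℚ`-lemmas on `E(ℚ)`).
* `bsdp_of_padicVal_printShape` — THE BRIDGE: `ord_{s=1} L(E,s) ≤ 1`, `E[p]` irreducible, print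
  shape ⇒ `BSDp W p`, granted Gross–Zagier–Kolyvagin (`rank_eq_analyticRank_of_analyticRank_le_one`,
  bsd.S17, a named tree fact supplying `rank = r_an` and `Ш` finite; taken BY NAME as the referee
  protocol R5/S2 prescribes). Bookkeeping only: `#Ш_an = q · #E(ℚ)_tors² / ∏ c_ℓ`,
  `ord_p #E(ℚ)_tors = 0`, `∏ c_ℓ ≥ 1` (`tamagawaProduct_pos_holds`), `ord_p #Ш(p) = ord_p #Ш` for
  finite `Ш` (`padicValNat_card_addPrimaryComponent`).
* `bsdp_of_padicVal_printShape_rankZero`: the same from the rank-`0` print shape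
  `ord_p(L(E,1)/Ω_E) = ord_p(#Ш · ∏ c_ℓ)` (`L^{(0)}(E,1)/0! = L(E,1)`,
  `leadingLCoeff_eq_of_analyticRank_eq_zero`; `Reg = 1` in rank `0`, `regulator_eq_one_of_rank_zero`).

References: R. L. Miller, LMS J. Comput. Math. 14 (2011), §1 and Def. 1.1 [Miller2011LMS];
B. Mazur, *Modular curves and the Eisenstein ideal*, IHÉS 47 (1977), p. 157 [Mazur1977];
J. H. Silverman, *AEC*, VIII.7, Cor. VII.6.2 [SilvermanAEC2009].
-/

noncomputable section

open WeierstrassCurve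

namespace Literature.NumberTheory.EllipticCurves.Rank1Residual

variable (W : WeierstrassCurve ℚ) [W.IsElliptic] (p : ℕ) [Fact p.Prime]

/-! ### Irreducible `E[p]` kills the torsion term -/

omit [W.IsElliptic] in
/-- The order of a rational point does not depend on the decidable-equality instance on `ℚ` used
by Mathlib's group law on affine points (`DecidableEq ℚ` is a subsingleton): the tree's lemmas over
a general number field carry the classical instance, its `ℚ`-lemmas the computable one.
[folklore] -/
theorem addOrderOf_point_eq_of_subsingleton (d₁ d₂ : DecidableEq ℚ) (P : W.toAffine.Point) :
    @addOrderOf _ (@SubNegMonoid.toAddMonoid _ (@AddGroup.toSubNegMonoid _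
      (@AddCommGroup.toAddGroup _ (@WeierstrassCurve.Affine.Point.instAddCommGroup ℚ _ W.toAffine d₁)))) P =
    @addOrderOf _ (@SubNegMonoid.toAddMonoid _ (@AddGroup.toSubNegMonoid _
      (@AddCommGroup.toAddGroup _ (@WeierstrassCurve.Affine.Point.instAddCommGroup ℚ _ W.toAffine d₂)))) P := by
  obtain rfl : d₁ = d₂ := Subsingleton.elim _ _
  rfl

/-- If `E[p]` is an irreducible `Γ_ℚ`-module then `E(ℚ)` has no point of order `p`, hence
`p ∤ #E(ℚ)_tors`, i.e. `ord_p #E(ℚ)_tors = 0`: otherwise Cauchy's theorem in the finite group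
`E(ℚ)_tors` (Silverman AEC VIII.7; tree `finite_torsion_point`) gives a rational point of order
`p`, which spans a `Γ_ℚ`-stable line in `E[p]` (Mazur 1977, p. 157; tree theorem
`not_exists_addOrderOf_eq_of_hasIrreducibleModPGaloisRep`). This is why the printed `p`-part
theorems under (irr) carry no torsion term. [cite: Mazur1977, Ch. III §5, p. 157] -/
theorem padicValNat_torsionOrder_eq_zero_of_irreducible (hirr : W.HasIrreducibleModPGaloisRep p) :
    padicValNat p W.torsionOrder = 0 := by
  refine padicValNat.eq_zero_of_not_dvd fun hdvd => ?_
  haveI := W.finite_torsion_point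
  unfold WeierstrassCurve.torsionOrder at hdvd
  obtain ⟨t, ht⟩ := exists_prime_addOrderOf_dvd_card' p hdvd
  -- the order of `t` in `E(ℚ)` (classical group-law instance, as in the tree's general lemmas)
  have ht' := (@AddSubgroup.addOrderOf_coe _ (@AddCommGroup.toAddGroup _
    (@WeierstrassCurve.Affine.Point.instAddCommGroup ℚ _ W.toAffine
      fun a b => Classical.propDecidable (a = b))) _ t).trans ht
  exact not_exists_addOrderOf_eq_of_hasIrreducibleModPGaloisRep W hirr
    ⟨(t : W.toAffine.Point), (addOrderOf_point_eq_of_subsingleton W _ _ _).trans ht'⟩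

/-! ### The bridge: print shape of the `p`-part ⇒ Miller's `BSD(E,p)` -/

/-- **Bridge.** For an elliptic curve `E/ℚ` with model `W` (intended globally minimal, so that
`W.realPeriodRat = Ω_E`), a prime `p` with `E[p]` irreducible and `ord_{s=1} L(E,s) ≤ 1`: the
`p`-part in PRINT SHAPE — `L^{(r)}(E,1)/(r! · Ω_E · Reg)` is a rational `q` with
`ord_p q = ord_p #Ш + ord_p ∏ c_ℓ` (Castella 2018 Thm. A, BCS 2025 Cor. 1.3.1, …: "`ord_p(L^{(r)}(E,1)
/(Reg(E/ℚ)·Ω_E)) = ord_p(#Ш(E/ℚ) ∏ c_ℓ)`") — implies Miller's `BSD(E,p)` (`BSDp W p`), granted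
the theorem of Gross–Zagier–Kolyvagin (`rank_eq_analyticRank_of_analyticRank_le_one`, bsd.S17:
`rank = r_an` and `Ш` finite). Bookkeeping: `#Ш_an = q · #E(ℚ)_tors² / ∏ c_ℓ` is rational and
`ord_p #Ш_an = ord_p q + 2 ord_p #E(ℚ)_tors − ord_p ∏ c_ℓ = ord_p #Ш = ord_p #Ш(p)`
(`padicValNat_torsionOrder_eq_zero_of_irreducible`, `tamagawaProduct_pos_holds`,
`padicValNat_card_addPrimaryComponent`). Miller 2011, §1: "If `r_an(E/ℚ) ≤ 1` then all but the
last part of `BSD(E/ℚ,p)` is known". [cite: Miller2011LMS, §1 and Def. 1.1 (arXiv:1010.2431 p. 3)] -/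
theorem bsdp_of_padicVal_printShape (hGZK : rank_eq_analyticRank_of_analyticRank_le_one)
    (hr : W.analyticRank ≤ 1) (hirr : W.HasIrreducibleModPGaloisRep p)
    (h : ∃ q : ℚ, W.leadingLCoeff / ((W.realPeriodRat * W.regulator : ℝ) : ℂ) = (q : ℂ) ∧
      padicValRat p q = (padicValNat p W.shaOrder : ℤ) + padicValNat p W.tamagawaProduct) :
    BSDp W p := by
  obtain ⟨hrank, hfin⟩ := hGZK W hr
  haveI : Finite W.sha := hfin
  obtain ⟨q, hq, hv⟩ := h
  have htors : padicValNat p W.torsionOrder = 0 :=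
    padicValNat_torsionOrder_eq_zero_of_irreducible W p hirr
  have hc : 0 < W.tamagawaProduct := W.tamagawaProduct_pos_holds
  have ht : 0 < W.torsionOrder := W.torsionOrder_pos_holds
  have hΩ : (W.realPeriodRat : ℂ) ≠ 0 := by exact_mod_cast W.realPeriodRat_pos_holds.ne'
  have hR : (W.regulator : ℂ) ≠ 0 := by exact_mod_cast (W.regulator_pos').ne'
  have hcC : (W.tamagawaProduct : ℂ) ≠ 0 := by exact_mod_cast hc.ne'
  refine ⟨hrank, Finite.of_injective _ Subtype.val_injective,
    q * (W.torsionOrder : ℚ) ^ 2 / (W.tamagawaProduct : ℚ), ?_, ?_⟩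
  · -- `#Ш_an = q · #tors² / ∏ c`
    rw [shaAn_def]
    have hL : W.leadingLCoeff = (q : ℂ) * ((W.realPeriodRat * W.regulator : ℝ) : ℂ) := by
      rw [← hq, div_mul_cancel₀]
      push_cast
      exact mul_ne_zero hΩ hR
    rw [hL]
    push_cast
    field_simp
  · -- valuations
    have hsha : padicValNat p (Nat.card (AddCommGroup.primaryComponent W.sha p)) =
        padicValNat p W.shaOrder := by
      rw [WeierstrassCurve.shaOrder, padicValNat_card_addPrimaryComponent]
    rw [hsha]
    by_cases hq0 : q = 0
    · -- degenerate bookkeeping: then `ord_p #Ш = 0` is forced by `hv`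
      subst hq0
      simp only [zero_mul, zero_div, padicValRat.zero] at hv ⊢
      omega
    · have htq : (W.torsionOrder : ℚ) ≠ 0 := by exact_mod_cast ht.ne'
      have hcq : (W.tamagawaProduct : ℚ) ≠ 0 := by exact_mod_cast hc.ne'
      rw [padicValRat.div (mul_ne_zero hq0 (pow_ne_zero 2 htq)) hcq,
        padicValRat.mul hq0 (pow_ne_zero 2 htq), padicValRat.pow, hv,
        padicValRat.of_nat, padicValRat.of_nat, htors]
      push_cast
      ring

/-- **Bridge, rank `0`.** If `ord_{s=1} L(E,s) = 0`, `E[p]` is irreducible, and the rank-`0` print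
shape holds — `L(E,1)/Ω_E` is a rational `q` with `ord_p q = ord_p #Ш + ord_p ∏ c_ℓ` (Skinner 2016
Thm. C: "`|L(E,1)/Ω_E|_p⁻¹ = |#Ш(E) ∏ c_ℓ(E)|_p⁻¹`"; Skinner–Urban 2014 Thm. 2 (a)) — then `BSDp W p`,
granted Gross–Zagier–Kolyvagin (`rank = r_an = 0`, `Ш` finite): `L^{(0)}(E,1)/0! = L(E,1)`
(`leadingLCoeff_eq_of_analyticRank_eq_zero`) and `Reg = 1` in rank `0`
(`regulator_eq_one_of_rank_zero`) turn it into the rank-`≤ 1` print shape.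
[cite: Miller2011LMS, §1 and Def. 1.1 (arXiv:1010.2431 p. 3)] -/
theorem bsdp_of_padicVal_printShape_rankZero (hGZK : rank_eq_analyticRank_of_analyticRank_le_one)
    (hr : W.analyticRank = 0) (hirr : W.HasIrreducibleModPGaloisRep p)
    (h : ∃ q : ℚ, W.entireLFunction 1 / (W.realPeriodRat : ℂ) = (q : ℂ) ∧
      padicValRat p q = (padicValNat p W.shaOrder : ℤ) + padicValNat p W.tamagawaProduct) :
    BSDp W p := by
  have hr1 : W.analyticRank ≤ 1 := by omega
  have hrank : W.mordellWeilRank = 0 := by rw [(hGZK W hr1).1, hr]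
  refine bsdp_of_padicVal_printShape W p hGZK hr1 hirr ?_
  obtain ⟨q, hq, hv⟩ := h
  refine ⟨q, ?_, hv⟩
  rw [W.leadingLCoeff_eq_of_analyticRank_eq_zero hr, W.regulator_eq_one_of_rank_zero hrank,
    mul_one]
  exact hq

end Literature.NumberTheory.EllipticCurves.Rank1Residual

end
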